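import Literature.NumberTheory.Automorphic.CMXiTorusCharSplitTorusDecay             -- ★ p826744: `torusDet_eq_one_of_torusEntry`, `exists_torusU_entry_eq`, `exists_map_eq_unitModulusChar_lt_one`, `quotConj_eq_one_of_map_eq`
import Literature.NumberTheory.Automorphic.CMLocalRingModulusContinuous             -- ★ p826943: `continuous_halfModulusChar_apply`
import Literature.NumberTheory.Automorphic.UnitaryGroupPrincipalSeriesExponents      -- ★ p825973: `cmTorusCharPair`, `cmWeylTorusCharPair` (= `wχ`), `conjInvChar`
import HarnessLib

/-!
# F0 · P3c · line LH6 «StCharTS» — «ST-CHAR★»: THE CASE-(1) CHARACTER PAIR `χ_St(ψ) = (‖·‖_E^{-1}, ψ)` OF [Rogawski1990, §12.2 (1)] on the torus of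
# `U(Φ₃)(L⁺_v)`, its Weyl conjugate `wχ_St(ψ) = (‖·‖_E, ψ)`, regularity `χ_St ≠ wχ_St`, and the Casselman signs on `A⁻ ∖ A(𝒪)` (datum road, slice S4b, file A)

Cell `pub/hodgecm-mathlib`, crux H413 = `stmt-HodgeConjecture-24833` (lane `--supports … --as helper`), route HCCMUnconditional; seat F0P2-p06 (g17).
THEOREMS ONLY (no definition ∕ instance ∕ notation ∕ named fact ∕ `sorry`); ★-only imports.

WHAT.  In case (1) of [Rogawski1990, §12.2 p. 173] («`JH(i_G(χ)) = {ψ∘det_G, St_G(ψ)}`») the principal series `i_G(χ)` = ★ `cmPrincipalSeries L 3 v χ` is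
NORMALISED induction (`f(tug) = χ(t) δ_B^{1/2}(t) f(g)`), and `δ_B^{1/2}(d(α, β, ᾱ⁻¹)) = ‖α‖_E` (★ `rootDeltaChar_cmBorel_torus`); so the one-dimensional `ψ∘det_G`
(`ψ ∈ Hom(E¹, ℂ^*)`) sits in `i_G(χ)` exactly for the PAIR `χ = χ_St(ψ) := (‖·‖_E^{-1}, ψ)` — in the tree's currency
`cmTorusCharPair L v (halfModulusChar R · halfModulusChar R)⁻¹ ψ`, `R = L ⊗ L⁺_v` (no definition is introduced: the pair is spelled out).  This file records:
* `stChar_apply`, `weylStChar_apply` — the values `χ_St(t) = ‖t₀₀‖⁻¹ · ψ(det t)`, `wχ_St(t) = ‖σ(t₀₀)‖ · ψ(det t)` (★ `cmWeylTorusCharPair`, `conjInvChar`);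
* `norm_stChar_of_split`, `norm_weylStChar_of_split` — on Casselman's `A = {d(a, 1, a⁻¹) : a = σ(a)}`: `‖χ_St(t)‖ = ‖a‖⁻¹`, `‖wχ_St(t)‖ = ‖a‖` (`det t = 1`, ★
  `torusDet_eq_one_of_torusEntry`);
* `decays_weylStChar` — `wχ_St` DECAYS on `A⁻ ∖ A(𝒪)` (Casselman's condition (b) of Thm 4.4.6 in the shape consumed by ★ `isSquareIntegrable_iff_decays`);
  `not_decays_stChar` — `χ_St` does not (witness `a = Nm(v)`, ★ `exists_map_eq_unitModulusChar_lt_one`);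
* `stChar_ne_weylStChar` — R1: the case-(1) character is REGULAR (`χ ≠ wχ`), the input of ★ `IrrClass.labelledPair_exists_of_line_abs`;
* `continuous_stFst` — the first coordinate is continuous (the hypothesis of the ★ letters N1∕N2∕N3∕N5 at this pair).
HONEST LABEL: HC_CM is proved only modulo the 7 printed citations (2 remaining named inputs: hLiu418 = `stmt-HodgeConjecture-24832`, h413 =
`stmt-HodgeConjecture-24833`) until rung 0 closes; this file closes no organ (count-neutral datum-road brick towards (ST-L2) of (S-𝔇)).

## References
* [Rogawski1990] J. D. Rogawski, *Automorphic Representations of Unitary Groups in Three Variables*, Ann. of Math. Stud. 123 (1990): §12.2 (1) p. 173 (case (1):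
  `ψ∘det_G` and `St_G(ψ)`), §1.10 p. 9 (the torus `M`), §12.1 p. 171.
* [Casselman1995] W. Casselman, *Introduction to the theory of admissible representations of `p`-adic reductive groups* (draft 1995), Thm 4.4.6 p. 45, §7.1 p. 67.
* [Keys1984] D. Keys, *Principal series representations of special unitary groups over local fields*, Compositio Math. 51 (1984), §7 Theorem.
-/

set_option autoImplicit false
-- the mandated namespace has the single-problem summit's repeated segment (`HodgeConjecture.HodgeConjecture`)
set_option linter.dupNamespace false

noncomputable section

open NumberField IsDedekindDomain MeasureTheory
open scoped Matrix MatrixGroups NNReal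
open Literature.NumberTheory.Automorphic Literature.NumberTheory.Automorphic.UnitaryGroup

namespace Summit.HodgeConjecture.HodgeConjecture.Cruxes.H413.F0P3cStCharTSStChar

variable (L : Type) [Field L] [NumberField L] [IsCMField L] (v : HeightOneSpectrum (𝓞 ↥(maximalRealSubfield L)))

/-! ## §1 Values of `χ_St(ψ) = (‖·‖⁻¹, ψ)` and `wχ_St(ψ) = (‖σ(·)‖, ψ)` -/

/-- **`χ_St(ψ)(t) = (‖t₀₀‖^{1/2} ‖t₀₀‖^{1/2})⁻¹ · ψ(det t)`** (unfolding of ★ `cmTorusCharPair` at the pair `((‖·‖^{1/2} ‖·‖^{1/2})⁻¹, ψ)`).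
[cite: Rogawski1990, §12.2 (1) p. 173; §12.1 p. 171] -/
theorem stChar_apply (ψ : ↥(normOneUnits (conjLocal L (IsCMField.complexConj L) v)) →* ℂˣ)
    (t : ↥(torusU (conjLocal L (IsCMField.complexConj L) v) (cmLocalForm L 3 v))) :
    cmTorusCharPair L v (halfModulusChar (LocalRing L v) * halfModulusChar (LocalRing L v))⁻¹ ψ t =
      (halfModulusChar (LocalRing L v) (torusEntry (conjLocal L (IsCMField.complexConj L) v) (cmLocalForm L 3 v) 0 t) *
          halfModulusChar (LocalRing L v) (torusEntry (conjLocal L (IsCMField.complexConj L) v) (cmLocalForm L 3 v) 0 t))⁻¹ *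
        ψ (torusDetNormOne (conjLocal L (IsCMField.complexConj L) v) (cmLocalForm L 3 v) (cmLocalForm_eq_over L 3 v) t) :=
  rfl

/-- **`wχ_St(ψ)(t) = ((‖σ t₀₀‖^{1/2} ‖σ t₀₀‖^{1/2})⁻¹)⁻¹ · ψ(det t)`** (★ `cmWeylTorusCharPair` = the pair `(χ̄₁⁻¹, χ₂)`, ★ `conjInvChar`).
[cite: Rogawski1990, §12.2 p. 173] -/
theorem weylStChar_apply (ψ : ↥(normOneUnits (conjLocal L (IsCMField.complexConj L) v)) →* ℂˣ)
    (t : ↥(torusU (conjLocal L (IsCMField.complexConj L) v) (cmLocalForm L 3 v))) :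
    cmWeylTorusCharPair L v (halfModulusChar (LocalRing L v) * halfModulusChar (LocalRing L v))⁻¹ ψ t =
      ((halfModulusChar (LocalRing L v) * halfModulusChar (LocalRing L v))⁻¹
          (Units.map ((conjLocal L (IsCMField.complexConj L) v : LocalRing L v →+* LocalRing L v) : LocalRing L v →* LocalRing L v)
            (torusEntry (conjLocal L (IsCMField.complexConj L) v) (cmLocalForm L 3 v) 0 t)))⁻¹ *
        ψ (torusDetNormOne (conjLocal L (IsCMField.complexConj L) v) (cmLocalForm L 3 v) (cmLocalForm_eq_over L 3 v) t) :=
  rfl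

omit [IsCMField L] in
/-- The norm of `‖a‖^{1/2} · ‖a‖^{1/2} ∈ ℂ` is `‖a‖` (the unit modulus, a real number). [cite: Rogawski1990, §12.2 p. 173] -/
theorem norm_halfModulusChar_mul_self (a : (LocalRing L v)ˣ) :
    ‖(((halfModulusChar (LocalRing L v) * halfModulusChar (LocalRing L v)) a : ℂˣ) : ℂ)‖ =
      ((unitModulusChar (LocalRing L v) a : ℝ≥0) : ℝ) := by
  rw [MonoidHom.mul_apply, Units.val_mul, ← sq, halfModulusChar_sq, Complex.norm_real, Real.norm_eq_abs, NNReal.abs_eq]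

/-- On Casselman's split torus `A = {d(a, 1, a⁻¹) : σ(a) = a}`: `det t = 1` in `E¹` (★ `torusDet_eq_one_of_torusEntry`). [cite: Rogawski1990, §1.10 p. 9]
[cite: Casselman1995, §7.1 p. 67] -/
theorem torusDetNormOne_eq_one_of_split (t : ↥(torusU (conjLocal L (IsCMField.complexConj L) v) (cmLocalForm L 3 v)))
    (hfix : conjLocal L (IsCMField.complexConj L) v
        ((torusEntry (conjLocal L (IsCMField.complexConj L) v) (cmLocalForm L 3 v) 0 t : (LocalRing L v)ˣ) : LocalRing L v) =
      (torusEntry (conjLocal L (IsCMField.complexConj L) v) (cmLocalForm L 3 v) 0 t : (LocalRing L v)ˣ))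
    (h1 : torusEntry (conjLocal L (IsCMField.complexConj L) v) (cmLocalForm L 3 v) 1 t = 1) :
    torusDetNormOne (conjLocal L (IsCMField.complexConj L) v) (cmLocalForm L 3 v) (cmLocalForm_eq_over L 3 v) t = 1 := by
  apply Subtype.ext
  rw [coe_torusDetNormOne]
  exact torusDet_eq_one_of_torusEntry (conjLocal L (IsCMField.complexConj L) v) (cmLocalForm L 3 v) (cmLocalForm_eq_over L 3 v) t hfix h1

/-- **`‖χ_St(ψ)(d(a, 1, a⁻¹))‖ = ‖a‖⁻¹`** for `σ`-fixed `a`. [cite: Casselman1995, §7.1 p. 67] [cite: Rogawski1990, §12.2 (1) p. 173] -/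
theorem norm_stChar_of_split (ψ : ↥(normOneUnits (conjLocal L (IsCMField.complexConj L) v)) →* ℂˣ)
    (t : ↥(torusU (conjLocal L (IsCMField.complexConj L) v) (cmLocalForm L 3 v)))
    (hfix : conjLocal L (IsCMField.complexConj L) v
        ((torusEntry (conjLocal L (IsCMField.complexConj L) v) (cmLocalForm L 3 v) 0 t : (LocalRing L v)ˣ) : LocalRing L v) =
      (torusEntry (conjLocal L (IsCMField.complexConj L) v) (cmLocalForm L 3 v) 0 t : (LocalRing L v)ˣ))
    (h1 : torusEntry (conjLocal L (IsCMField.complexConj L) v) (cmLocalForm L 3 v) 1 t = 1) :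
    ‖((cmTorusCharPair L v (halfModulusChar (LocalRing L v) * halfModulusChar (LocalRing L v))⁻¹ ψ t : ℂˣ) : ℂ)‖ =
      (((unitModulusChar (LocalRing L v) (torusEntry (conjLocal L (IsCMField.complexConj L) v) (cmLocalForm L 3 v) 0 t)) : ℝ≥0) : ℝ)⁻¹ := by
  rw [stChar_apply, torusDetNormOne_eq_one_of_split L v t hfix h1, map_one, mul_one, Units.val_inv_eq_inv_val, norm_inv,
    ← MonoidHom.mul_apply, norm_halfModulusChar_mul_self]

/-- **`‖wχ_St(ψ)(d(a, 1, a⁻¹))‖ = ‖a‖`** for `σ`-fixed `a`. [cite: Casselman1995, §7.1 p. 67] [cite: Rogawski1990, §12.2 p. 173] -/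
theorem norm_weylStChar_of_split (ψ : ↥(normOneUnits (conjLocal L (IsCMField.complexConj L) v)) →* ℂˣ)
    (t : ↥(torusU (conjLocal L (IsCMField.complexConj L) v) (cmLocalForm L 3 v)))
    (hfix : conjLocal L (IsCMField.complexConj L) v
        ((torusEntry (conjLocal L (IsCMField.complexConj L) v) (cmLocalForm L 3 v) 0 t : (LocalRing L v)ˣ) : LocalRing L v) =
      (torusEntry (conjLocal L (IsCMField.complexConj L) v) (cmLocalForm L 3 v) 0 t : (LocalRing L v)ˣ))
    (h1 : torusEntry (conjLocal L (IsCMField.complexConj L) v) (cmLocalForm L 3 v) 1 t = 1) :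
    ‖((cmWeylTorusCharPair L v (halfModulusChar (LocalRing L v) * halfModulusChar (LocalRing L v))⁻¹ ψ t : ℂˣ) : ℂ)‖ =
      ((unitModulusChar (LocalRing L v) (torusEntry (conjLocal L (IsCMField.complexConj L) v) (cmLocalForm L 3 v) 0 t) : ℝ≥0) : ℝ) := by
  have hma : Units.map ((conjLocal L (IsCMField.complexConj L) v : LocalRing L v →+* LocalRing L v) : LocalRing L v →* LocalRing L v)
      (torusEntry (conjLocal L (IsCMField.complexConj L) v) (cmLocalForm L 3 v) 0 t) =
      torusEntry (conjLocal L (IsCMField.complexConj L) v) (cmLocalForm L 3 v) 0 t := Units.ext hfix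
  rw [weylStChar_apply, torusDetNormOne_eq_one_of_split L v t hfix h1, map_one, mul_one, hma, MonoidHom.inv_apply, inv_inv,
    norm_halfModulusChar_mul_self]

/-! ## §2 Casselman's signs on `A⁻ ∖ A(𝒪)`: `wχ_St` decays, `χ_St` does not; regularity `χ_St ≠ wχ_St` -/

/-- **`wχ_St(ψ) = (‖·‖, ψ)` DECAYS on `A⁻ ∖ A(𝒪)`**: `‖wχ_St(d(a, 1, a⁻¹))‖ = ‖a‖ < 1` for `σ`-fixed `a` with `‖a‖ < 1` — Casselman's condition (b) of Thm 4.4.6 for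
the exponent of `St_G(ψ)`, in the binder shape of ★ `F0P3KeysCaseTwoOfStubs.isSquareIntegrable_iff_decays`. [cite: Casselman1995, Thm 4.4.6 (b) p. 45, §7.1 p. 67]
[cite: Rogawski1990, §12.2 (1) p. 173] -/
theorem decays_weylStChar (ψ : ↥(normOneUnits (conjLocal L (IsCMField.complexConj L) v)) →* ℂˣ) :
    ∀ t : ↥(torusU (conjLocal L (IsCMField.complexConj L) v) (cmLocalForm L 3 v)),
      conjLocal L (IsCMField.complexConj L) v
          ((torusEntry (conjLocal L (IsCMField.complexConj L) v) (cmLocalForm L 3 v) 0 t : (LocalRing L v)ˣ) : LocalRing L v) =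
        ((torusEntry (conjLocal L (IsCMField.complexConj L) v) (cmLocalForm L 3 v) 0 t : (LocalRing L v)ˣ) : LocalRing L v) →
      torusEntry (conjLocal L (IsCMField.complexConj L) v) (cmLocalForm L 3 v) 1 t = 1 →
      unitModulusChar (LocalRing L v) (torusEntry (conjLocal L (IsCMField.complexConj L) v) (cmLocalForm L 3 v) 0 t) < 1 →
      ‖((cmWeylTorusCharPair L v (halfModulusChar (LocalRing L v) * halfModulusChar (LocalRing L v))⁻¹ ψ t : ℂˣ) : ℂ)‖ < 1 := by
  intro t hfix h1 hm
  rw [norm_weylStChar_of_split L v ψ t hfix h1, ← NNReal.coe_one, NNReal.coe_lt_coe]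
  exact hm

/-- **`χ_St(ψ) = (‖·‖⁻¹, ψ)` does NOT decay on `A⁻ ∖ A(𝒪)`**: at `a = Nm(v)` (★ `exists_map_eq_unitModulusChar_lt_one`), `‖χ_St(d(a, 1, a⁻¹))‖ = ‖a‖⁻¹ > 1` — so
the constituent of `i_G(χ_St)` with exponent `χ_St` (the one-dimensional `ψ∘det_G`) is not square-integrable. [cite: Casselman1995, Thm 4.4.6 (b) p. 45, §7.1 p. 67]
[cite: Rogawski1990, §12.2 (1) p. 173] -/
theorem exists_one_lt_norm_stChar (ψ : ↥(normOneUnits (conjLocal L (IsCMField.complexConj L) v)) →* ℂˣ) :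
    ∃ t : ↥(torusU (conjLocal L (IsCMField.complexConj L) v) (cmLocalForm L 3 v)),
      conjLocal L (IsCMField.complexConj L) v
          ((torusEntry (conjLocal L (IsCMField.complexConj L) v) (cmLocalForm L 3 v) 0 t : (LocalRing L v)ˣ) : LocalRing L v) =
        ((torusEntry (conjLocal L (IsCMField.complexConj L) v) (cmLocalForm L 3 v) 0 t : (LocalRing L v)ˣ) : LocalRing L v) ∧
      torusEntry (conjLocal L (IsCMField.complexConj L) v) (cmLocalForm L 3 v) 1 t = 1 ∧
      unitModulusChar (LocalRing L v) (torusEntry (conjLocal L (IsCMField.complexConj L) v) (cmLocalForm L 3 v) 0 t) < 1 ∧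
      1 < ‖((cmTorusCharPair L v (halfModulusChar (LocalRing L v) * halfModulusChar (LocalRing L v))⁻¹ ψ t : ℂˣ) : ℂ)‖ := by
  obtain ⟨a, hfix, hm⟩ := exists_map_eq_unitModulusChar_lt_one L v (conjLocal L (IsCMField.complexConj L) v)
  obtain ⟨t, ht0, ht1⟩ := exists_torusU_entry_eq (conjLocal L (IsCMField.complexConj L) v) (cmLocalForm L 3 v)
    (cmLocalForm_eq_over L 3 v) a hfix
  have hfix' : conjLocal L (IsCMField.complexConj L) v
      ((torusEntry (conjLocal L (IsCMField.complexConj L) v) (cmLocalForm L 3 v) 0 t : (LocalRing L v)ˣ) : LocalRing L v) =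
      (torusEntry (conjLocal L (IsCMField.complexConj L) v) (cmLocalForm L 3 v) 0 t : (LocalRing L v)ˣ) := by
    rw [ht0]; exact hfix
  have hm' : unitModulusChar (LocalRing L v) (torusEntry (conjLocal L (IsCMField.complexConj L) v) (cmLocalForm L 3 v) 0 t) < 1 := by
    rw [ht0]; exact hm
  refine ⟨t, hfix', ht1, hm', ?_⟩
  have hpos : 0 < unitModulusChar (LocalRing L v) a := distribHaarChar_pos (A := LocalRing L v) (g := a)
  rw [norm_stChar_of_split L v ψ t hfix' ht1, ht0, ← NNReal.coe_inv, ← NNReal.coe_one, NNReal.coe_lt_coe]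
  exact (one_lt_inv₀ hpos).2 hm

/-- **`χ_St(ψ)` does not decay** (negation of Casselman's condition (b), in the binder shape of ★ `isSquareIntegrable_iff_decays`).
[cite: Casselman1995, Thm 4.4.6 (b) p. 45] [cite: Rogawski1990, §12.2 (1) p. 173] -/
theorem not_decays_stChar (ψ : ↥(normOneUnits (conjLocal L (IsCMField.complexConj L) v)) →* ℂˣ) :
    ¬ ∀ t : ↥(torusU (conjLocal L (IsCMField.complexConj L) v) (cmLocalForm L 3 v)),
      conjLocal L (IsCMField.complexConj L) v
          ((torusEntry (conjLocal L (IsCMField.complexConj L) v) (cmLocalForm L 3 v) 0 t : (LocalRing L v)ˣ) : LocalRing L v) =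
        ((torusEntry (conjLocal L (IsCMField.complexConj L) v) (cmLocalForm L 3 v) 0 t : (LocalRing L v)ˣ) : LocalRing L v) →
      torusEntry (conjLocal L (IsCMField.complexConj L) v) (cmLocalForm L 3 v) 1 t = 1 →
      unitModulusChar (LocalRing L v) (torusEntry (conjLocal L (IsCMField.complexConj L) v) (cmLocalForm L 3 v) 0 t) < 1 →
      ‖((cmTorusCharPair L v (halfModulusChar (LocalRing L v) * halfModulusChar (LocalRing L v))⁻¹ ψ t : ℂˣ) : ℂ)‖ < 1 := by
  intro hdec
  obtain ⟨t, hfix, h1, hm, hlt⟩ := exists_one_lt_norm_stChar L v ψ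
  exact absurd (hdec t hfix h1 hm) (not_lt.2 hlt.le)

/-- **R1 — the case-(1) character is REGULAR: `χ_St(ψ) ≠ wχ_St(ψ)`** (at the witness of `exists_one_lt_norm_stChar`, `‖χ_St(t)‖ > 1 > ‖wχ_St(t)‖`); the input
`hreg` of ★ `IrrClass.labelledPair_exists_of_line_abs` («the two constituents have distinct exponents»). [cite: Rogawski1990, §12.2 (1) p. 173] [cite: Casselman1995, Prop. 6.4.1, §7.1] -/
theorem stChar_ne_weylStChar (ψ : ↥(normOneUnits (conjLocal L (IsCMField.complexConj L) v)) →* ℂˣ) :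
    cmTorusCharPair L v (halfModulusChar (LocalRing L v) * halfModulusChar (LocalRing L v))⁻¹ ψ ≠
      cmWeylTorusCharPair L v (halfModulusChar (LocalRing L v) * halfModulusChar (LocalRing L v))⁻¹ ψ := by
  intro h
  obtain ⟨t, hfix, h1, hm, hlt⟩ := exists_one_lt_norm_stChar L v ψ
  have hlt1 := decays_weylStChar L v ψ t hfix h1 hm
  rw [← h] at hlt1
  exact absurd hlt1 (not_lt.2 hlt.le)

/-- The same inequality read from the other side: `wχ_St(ψ) ≠ χ_St(ψ)`. [cite: Rogawski1990, §12.2 (1) p. 173] -/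
theorem weylStChar_ne_stChar (ψ : ↥(normOneUnits (conjLocal L (IsCMField.complexConj L) v)) →* ℂˣ) :
    cmWeylTorusCharPair L v (halfModulusChar (LocalRing L v) * halfModulusChar (LocalRing L v))⁻¹ ψ ≠
      cmTorusCharPair L v (halfModulusChar (LocalRing L v) * halfModulusChar (LocalRing L v))⁻¹ ψ :=
  (stChar_ne_weylStChar L v ψ).symm

/-! ## §3 Continuity of the first coordinate `‖·‖⁻¹` -/

omit [IsCMField L] in
/-- **`x ↦ (‖x‖^{1/2} ‖x‖^{1/2})⁻¹ ∈ ℂ` is continuous on `(L ⊗ L⁺_v)^×`** (★ `continuous_halfModulusChar_apply`; the value is never `0`) — the hypothesis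
«`Continuous fun x => ((χ₁ x : ℂˣ) : ℂ)`» of the ★ letters N1 ∕ N2 ∕ N3 ∕ N5 at `χ₁ = ‖·‖⁻¹`. [cite: Rogawski1990, §12.2 p. 173] -/
theorem continuous_stFst :
    Continuous fun x : (LocalRing L v)ˣ => ((((halfModulusChar (LocalRing L v) * halfModulusChar (LocalRing L v))⁻¹) x : ℂˣ) : ℂ) := by
  have h : (fun x : (LocalRing L v)ˣ => ((((halfModulusChar (LocalRing L v) * halfModulusChar (LocalRing L v))⁻¹) x : ℂˣ) : ℂ)) =
      fun x => (((halfModulusChar (LocalRing L v) x : ℂˣ) : ℂ) * ((halfModulusChar (LocalRing L v) x : ℂˣ) : ℂ))⁻¹ := by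
    funext x
    rw [MonoidHom.inv_apply, MonoidHom.mul_apply, Units.val_inv_eq_inv_val, Units.val_mul]
  rw [h]
  refine Continuous.inv₀ ((continuous_halfModulusChar_apply L v).mul (continuous_halfModulusChar_apply L v)) fun x => ?_
  rw [← Units.val_mul]
  exact Units.ne_zero _

end Summit.HodgeConjecture.HodgeConjecture.Cruxes.H413.F0P3cStCharTSStChar

end
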